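import Literature.AlgebraicGeometry.Frobenioids.ArchimedeanClausesD
import HarnessLib

/-!
# Frobenioids II, Example 3.3 (ii): [FrdI] Def. 1.3 (iv)(a) for `C₀` — the canonical factorisation

Mochizuki, *The geometry of Frobenioids II: poly-Frobenioids*, Kyushu J. Math. **62** (2008)
401–460, §3, Example 3.3 (ii), author's text p. 28 [cite: MochizukiFrdII2008, Ex 3.3 (ii) p.28];
clause (iv)(a) of [FrdI] Def. 1.3 (found's `Frobenioid.lean`) for abc-iut-L1-t6's `C₀ → F_{Φ₀}`.
PROOF-ONLY file (no definition).  Every arrow `φ = (f, d, c) : (L, B_L, λ_L) → (K, B_K, λ_K)`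
factors as `(L, B_L, λ_L) →(𝟙,d,1)→ (L, B_L^d, λ_L^d) →(𝟙,1,c)→ (L, A_K|_f) →(f,1,1)→ (K, B_K, λ_K)`:
Frobenius type, then pre-step, then pull-back morphism (`iv_a_exists`); and such a factorisation is
unique up to the evident isomorphisms (`iv_a_unique`: the Frobenius-type parts are compared by
Def. 1.3 (ii), the pull-back parts by the universal property of pull-back morphisms, using that
`C₀` is totally epimorphic).
-/

namespace Literature.AlgebraicGeometry.Frobenioids

open CategoryTheory Set Function Topology
open scoped Pointwise

noncomputable section

namespace ArchFrd

namespace C0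

variable {X Y Z : C0}

/-! ### Lifting through pull-back morphisms -/

/-- Existence of lifts through a pull-back morphism (its defining universal property).
[cite: MochizukiFrdI2008, Def. 1.2(ii)] -/
theorem pullback_lift (α : Y ⟶ Z) (hα : PreFrobenioid.IsPullbackMorphism toElem α) (ψ : X ⟶ Z)
    (g : X.base ⟶ Y.base) (hg : Base ψ = g ≫ Base α) : ∃ χ : X ⟶ Y, χ ≫ α = ψ ∧ Base χ = g := by
  obtain ⟨χ, hχ⟩ := (hα X).2 ⟨(ψ, g), hg⟩
  exact ⟨χ, congrArg (fun p : PreFrobenioid.PullbackHomData toElem α X => p.1.1) hχ,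
    congrArg (fun p : PreFrobenioid.PullbackHomData toElem α X => p.1.2) hχ⟩

/-- Uniqueness of lifts through a pull-back morphism. [cite: MochizukiFrdI2008, Def. 1.2(ii)] -/
theorem pullback_lift_unique (α : Y ⟶ Z) (hα : PreFrobenioid.IsPullbackMorphism toElem α)
    (χ χ' : X ⟶ Y) (h₁ : χ ≫ α = χ' ≫ α) (h₂ : Base χ = Base χ') : χ = χ' :=
  (hα X).1 (Subtype.ext (Prod.ext h₁ h₂))

/-! ### Def. 1.3 (iv)(a) -/

/-- **Def. 1.3 (iv)(a), existence, for `C₀`**: `φ = (f, d, c)` is the composite of the morphism of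
Frobenius type `(𝟙, d, 1) : (L, B, λ) → (L, B^d, λ^d)`, the pre-step `(𝟙, 1, c) : (L, B^d, λ^d) →
(L, A_K|_f)` and the pull-back morphism `(f, 1, 1) : (L, A_K|_f) → (K, A_K)`.
[cite: MochizukiFrdII2008, Ex 3.3 (ii) p.28] -/
theorem iv_a_exists {A B : C0} (φ : A ⟶ B) :
    ∃ (X Y : C0) (γ : A ⟶ X) (β : X ⟶ Y) (α : Y ⟶ B), γ ≫ β ≫ α = φ ∧
      PreFrobenioid.IsFrobeniusType toElem γ ∧ PreFrobenioid.IsPreStep toElem β ∧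
        PreFrobenioid.IsPullbackMorphism toElem α := by
  -- `X = (L, B^d, λ^d)`
  have hd : (degFr φ : ℕ) = (degFr φ).natPred + 1 := (PNat.natPred_add_one _).symm
  obtain ⟨R₁, hR₁d, hR₁t⟩ := exists_angularRegion (B := A.region.dir ^ (degFr φ : ℕ))
    (by rw [hd]; exact isOpen_pow A.region.isOpen_dir _)
    (by rw [hd]; exact isConnected_pow A.region.isConnected_dir _) (A.region.tip ^ (degFr φ : ℕ))
  have hR₁ : A.base = D0.real → R₁.IsIsotropic := fun h => by
    change R₁.dir = univ
    rw [hR₁d, show A.region.dir = univ from A.isIsotropic_of_isReal h, Set.univ_pow (PNat.ne_zero _)]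
  let X : C0 := ⟨A.base, R₁, hR₁⟩
  -- `Y = (L, A_K|_f)`
  obtain ⟨R₂, hR₂c, hR₂t, hR₂d, hR₂i⟩ := exists_pulledRegion B (Base φ)
  have hR₂ : A.base = D0.real → R₂.IsIsotropic := fun h =>
    hR₂i (isNaivelyIsotropic_of_isRealObj (isRealObj_of_hom φ h))
  let Y : C0 := ⟨A.base, R₂, hR₂⟩
  -- `γ = (𝟙, d, 1)`
  obtain ⟨A₁, hA₁c, hA₁t, hA₁d, -⟩ := exists_pulledRegion X (𝟙 A.base)
  rw [twist_id_image] at hA₁d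
  obtain ⟨γ, hγb, hγd, hγc⟩ := exists_hom A X (𝟙 A.base) (degFr φ) (one_mem _) hA₁c
    (by rw [hA₁d, unitPart_one, one_smul]; exact hR₁d.symm.subset)
    (by
      rw [hA₁t, Units.val_one, norm_one, one_mul]
      change _ ≤ ((R₁.tip : PosReal) : ℝ)
      rw [hR₁t, Positive.val_pow]; rfl)
  -- `β = (𝟙, 1, c)`
  obtain ⟨A₂, hA₂c, hA₂t, hA₂d, -⟩ := exists_pulledRegion Y (𝟙 A.base)
  rw [twist_id_image] at hA₂d
  obtain ⟨h1, h2⟩ := hom_conditions φ hR₂c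
  obtain ⟨β, hβb, hβd, hβc⟩ := exists_hom X Y (𝟙 A.base) 1 φ.scalar_mem hA₂c
    (by
      rw [hA₂d, PNat.one_coe, pow_one]
      change unitPart ℂ (scalar φ) • R₁.dir ⊆ R₂.dir
      rw [hR₁d]
      exact h1)
    (by
      rw [hA₂t, PNat.one_coe, pow_one]
      change ‖(scalar φ : ℂ)‖ * ((R₁.tip : PosReal) : ℝ) ≤ (R₂.tip : ℝ)
      rw [hR₁t, Positive.val_pow, ← tip_eq]
      exact h2)
  -- `α = (f, 1, 1)`
  obtain ⟨α, hαb, hαd, hαc⟩ := exists_hom Y B φ.base 1 (one_mem _) hR₂c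
    (fun z hz => by rwa [unitPart_one, one_smul, PNat.one_coe, pow_one] at hz)
    (le_of_eq (by rw [Units.val_one, norm_one, one_mul, PNat.one_coe, pow_one, tip_eq]))
  refine ⟨X, Y, γ, β, α, hom_ext ?_ ?_ ?_, ?_, ⟨hβd, ?_⟩, ?_⟩
  · rw [base_comp', base_comp', hγb, hβb, hαb, Category.id_comp, Category.id_comp]
  · rw [degFr_comp', degFr_comp', hγd, hβd, hαd, mul_one, mul_one]
  · rw [scalar_comp', scalar_comp', degFr_comp', hγb, hγc, hβb, hβc, hαc, hαd, hβd, map_one, one_mul,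
      one_pow, mul_one, PNat.one_coe, pow_one]
    change D0.galAct (D0.Hom.twists (𝟙 A.base)) (scalar φ) = scalar φ
    rw [D0.twists_id, D0.galAct_false]
  · refine (isFrobeniusType_iff γ).2 ⟨fun _ => ?_, ?_, ?_⟩
    · rw [image_unitPart_homImage, image_unitPart_pullRegion, hγc, unitPart_one, one_smul, hγd, hγb,
        twist_id_image]
      exact hR₁d.symm
    · rw [hγc, hγd, Units.val_one, norm_one, one_mul]
      change _ = ((R₁.tip : PosReal) : ℝ)
      rw [hR₁t, Positive.val_pow]; rfl
    · rw [hγb]; infer_instance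
  · rw [isBaseIso_iff, hβb]; infer_instance
  · refine (isPullbackMorphism_iff α).2 ⟨hαd, ?_⟩
    rw [hαc, one_smul, hαb]
    exact hR₂c

/-- **Def. 1.3 (iv)(a), uniqueness, for `C₀`**: two factorisations `φ = α ∘ β ∘ γ = α' ∘ β' ∘ γ'`
(Frobenius type, pre-step, pull-back) differ by unique isomorphisms `ε : X ≅ X'`, `δ : Y ≅ Y'`:
`ε` compares the Frobenius-type parts (Def. 1.3 (ii), same degree `deg_Fr(φ)`), and `δ` is the
lift of `α` through the pull-back morphism `α'` over `Base(β)⁻¹ Base(ε) Base(β')`.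
[cite: MochizukiFrdII2008, Ex 3.3 (ii) p.28] -/
theorem iv_a_unique {A B X Y X' Y' : C0} (φ : A ⟶ B) (γ : A ⟶ X) (β : X ⟶ Y) (α : Y ⟶ B)
    (γ' : A ⟶ X') (β' : X' ⟶ Y') (α' : Y' ⟶ B)
    (h : γ ≫ β ≫ α = φ) (hγ : PreFrobenioid.IsFrobeniusType toElem γ)
    (hβ : PreFrobenioid.IsPreStep toElem β) (hα : PreFrobenioid.IsPullbackMorphism toElem α)
    (h' : γ' ≫ β' ≫ α' = φ) (hγ' : PreFrobenioid.IsFrobeniusType toElem γ')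
    (hβ' : PreFrobenioid.IsPreStep toElem β') (hα' : PreFrobenioid.IsPullbackMorphism toElem α') :
    ∃ (ε : X ≅ X') (δ : Y ≅ Y'), γ ≫ ε.hom = γ' ∧ β ≫ δ.hom = ε.hom ≫ β' ∧ α = δ.hom ≫ α' := by
  -- degrees
  have hdα : degFr α = 1 := (iv_b α hα).2
  have hdα' : degFr α' = 1 := (iv_b α' hα').2
  have hdeg : degFr γ = degFr γ' := by
    have e := congrArg degFr h
    have e' := congrArg degFr h'
    rw [degFr_comp', degFr_comp', show degFr β = 1 from hβ.1, hdα, mul_one, mul_one] at e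
    rw [degFr_comp', degFr_comp', show degFr β' = 1 from hβ'.1, hdα', mul_one, mul_one] at e'
    rw [e, e']
  -- `ε`
  obtain ⟨ε, hε⟩ := isFrobeniusType_unique γ γ' hγ hγ' hdeg
  haveI : IsIso (Base β) := hβ.2
  haveI : IsIso (Base β') := hβ'.2
  haveI : IsIso (Base ε.hom) := ((isIso_iff ε.hom).1 inferInstance).1
  haveI : Epi γ := isTotallyEpimorphic.epi γ
  -- `β α = ε β' α'`
  have E1 : β ≫ α = ε.hom ≫ β' ≫ α' := by
    rw [← cancel_epi γ, h, ← Category.assoc, hε, h']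
  -- the base of `δ`
  have hg : Base α = (inv (Base β) ≫ Base ε.hom ≫ Base β') ≫ Base α' := by
    have := congrArg Base E1
    rw [base_comp', base_comp', base_comp'] at this
    rw [Category.assoc, Category.assoc, ← this, IsIso.inv_hom_id_assoc]
  have hg' : Base α' = inv (inv (Base β) ≫ Base ε.hom ≫ Base β') ≫ Base α := by
    rw [IsIso.eq_inv_comp, hg]
  -- `δ` and its inverse
  obtain ⟨δ₁, hδ₁α, hδ₁b⟩ := pullback_lift α' hα' α _ hg
  obtain ⟨δ₂, hδ₂α, hδ₂b⟩ := pullback_lift α hα α' _ hg'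
  have h₁₂ : δ₁ ≫ δ₂ = 𝟙 Y := pullback_lift_unique α hα _ _
    (by rw [Category.assoc, hδ₂α, hδ₁α, Category.id_comp])
    (by rw [base_comp', hδ₁b, hδ₂b, IsIso.hom_inv_id, base_id'])
  have h₂₁ : δ₂ ≫ δ₁ = 𝟙 Y' := pullback_lift_unique α' hα' _ _
    (by rw [Category.assoc, hδ₁α, hδ₂α, Category.id_comp])
    (by rw [base_comp', hδ₁b, hδ₂b, IsIso.inv_hom_id, base_id'])
  refine ⟨ε, ⟨δ₁, δ₂, h₁₂, h₂₁⟩, hε, ?_, hδ₁α.symm⟩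
  refine pullback_lift_unique α' hα' _ _ ?_ ?_
  · rw [Category.assoc, hδ₁α, Category.assoc]
    exact E1
  · rw [base_comp', base_comp', hδ₁b, IsIso.hom_inv_id_assoc]

end C0

end ArchFrd

end

end Literature.AlgebraicGeometry.Frobenioids
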